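import Literature.Analysis.OperatorTheory.YangMillsMatrixModelRotationAverage
import Literature.Analysis.PDE.HopfMinimumPrinciple
import Mathlib.Analysis.Convex.PathConnected
import HarnessLib

/-!
# Strict positivity of non-negative eigenfunctions of Lüscher's matrix-model Hamiltonian

Topic `Literature/Analysis/OperatorTheory`; the positivity step of the simplicity of the invariant ground
state of `𝔥 = −½Δ + V` on `ℝ⁹` (`LuscherSimonGap`, `YangMillsMatrixModelDiscreteSpectrum.lean`), i.e. the
«positivity improving» hypothesis `hpos` of the abstract Perron–Frobenius/variational criterion
`Literature.Analysis.UnboundedOperators.sInf_coreLevelSet_zero_lt_one` (Lieb–Loss Thm. 11.8 / RS-IV XIII.48)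
for THIS operator:

* `fderiv_fderiv_comp_clm` — chain rule for second derivatives along a continuous linear map;
* ★ `eq_zero_of_nonneg_of_hApply_eq` — **E. Hopf's strong minimum principle for `𝔥 − E`**: a `C²` function
  `f ≥ 0` with `𝔥f = Ef` on `ℝ⁹` which vanishes at one point vanishes identically (the tree's
  `Literature.Analysis.PDE.hopf_minimumPrinciple`, López-Gómez Thm. 1.2, transported from
  `EuclideanSpace ℝ (Fin 9)` to `ℝ⁹ = (ℝ³)³` by the reindexing isometry, applied to
  `𝔏 = −½Δ + (V − E)⁺` with `𝔏f = (V − E)⁻ f ≥ 0`); `pos_or_eq_zero_of_nonneg_of_hApply_eq`;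
* ★ `inner_pos_of_weak_invariant_nonneg` — **positivity improving in the variational form**: a non-zero,
  non-negative `w ∈ L²(ℝ⁹)` in the closure of the invariant core satisfying the weak eigen-equation against
  the invariant core has `⟪w, v⟫ > 0` for every non-zero `v ≥ 0` in `L²` (by N3/N4 of
  `YangMillsMatrixModelRotationAverage.lean`, `w` is a.e. a smooth classical solution `f ≥ 0`, `f ≢ 0`,
  hence `f > 0` everywhere).

Theorems only; no definitions, no named facts.

## References
* [LopezGomez2012] J. López-Gómez, *Linear Second Order Elliptic Operators*, Ch. 1 Thm. 1.2 (minimum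
  principle of E. Hopf).
* [LiebLoss2001] E. H. Lieb, M. Loss, *Analysis*, 2nd ed., Thm. 9.10 (harmonic functions: strong maximum
  principle), Thm. 11.8 (uniqueness and positivity of minimizers, PDF pp. 205–206).
* [ReedSimonIV1978] M. Reed, B. Simon, *Methods of Modern Mathematical Physics IV*, §XIII.12, Thm. XIII.48
  (Schrödinger semigroups are positivity improving; the ground state is strictly positive).
-/

noncomputable section

open MeasureTheory Filter Set Function Metric
open scoped BigOperators RealInnerProductSpace ContDiff Topology

namespace Literature.Analysis.OperatorTheory.YMMatrixModel

/-! ### 1. Second derivatives along a linear change of variables -/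

/-- Chain rule for the Hessian along a continuous linear map `L`:
`D²(f∘L)(y)(v, w) = D²f(Ly)(Lv, Lw)` for `f ∈ C²`. [cite: LiebLoss2001, Thm. 9.10] -/
theorem fderiv_fderiv_comp_clm {F : Type*} [NormedAddCommGroup F] [NormedSpace ℝ F]
    (L : F →L[ℝ] ZM) {f : ZM → ℝ} (hf : ContDiff ℝ 2 f) (y v w : F) :
    fderiv ℝ (fderiv ℝ (fun z => f (L z))) y v w = fderiv ℝ (fderiv ℝ f) (L y) (L v) (L w) := by
  have hfd : Differentiable ℝ f := hf.differentiable (by norm_num)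
  have hDfd : Differentiable ℝ (fderiv ℝ f) :=
    (hf.fderiv_right (m := 1) (by norm_num)).differentiable (by norm_num)
  have h1 : fderiv ℝ (fun z => f (L z)) = fun z => (fderiv ℝ f (L z)).comp L := by
    funext z
    rw [show (fun z => f (L z)) = f ∘ ⇑L from rfl, fderiv_comp z (hfd (L z)) L.differentiableAt,
      ContinuousLinearMap.fderiv]
  have hA : HasFDerivAt (fun z => fderiv ℝ f (L z)) ((fderiv ℝ (fderiv ℝ f) (L y)).comp L) y :=
    (hDfd (L y)).hasFDerivAt.comp y L.hasFDerivAt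
  have hB := hA.clm_comp (hasFDerivAt_const L y)
  rw [h1, hB.fderiv]
  simp

/-- The Laplacian of `ℝ⁹ = (ℝ³)³` is the trace of the Hessian in ANY orthonormal basis; here for the
basis obtained from the standard basis of `EuclideanSpace ℝ (Fin 9)` by the reindexing isometry.
[cite: LiebLoss2001, Thm. 9.10] -/
theorem laplacian_eq_sum_fderiv_fderiv_onb {ι : Type*} [Fintype ι] [DecidableEq ι]
    (b : OrthonormalBasis ι ℝ ZM) {f : ZM → ℝ} (hf : ContDiff ℝ 2 f) (x : ZM) :
    laplacian f x = ∑ i, fderiv ℝ (fderiv ℝ f) x (b i) (b i) := by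
  have hDfd : Differentiable ℝ (fderiv ℝ f) :=
    (hf.fderiv_right (m := 1) (by norm_num)).differentiable (by norm_num)
  have hstd : ∀ p, pderiv p (pderiv p f) x = fderiv ℝ (fderiv ℝ f) x (unitDir p) (unitDir p) := by
    intro p
    have h1 : pderiv p f = fun z => fderiv ℝ f z (unitDir p) := rfl
    rw [pderiv, h1, fderiv_clm_apply (hDfd _) (differentiableAt_const _)]
    simp
  rw [laplacian_def]
  simp only [hstd]
  set β : ZM →L[ℝ] ZM →L[ℝ] ℝ := fderiv ℝ (fderiv ℝ f) x with hβ
  set s : OrthonormalBasis (Fin 3 × Fin 3) ℝ ZM := EuclideanSpace.basisFun (Fin 3 × Fin 3) ℝ with hs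
  have hs_apply : ∀ p, s p = unitDir p := fun p => by
    rw [hs, EuclideanSpace.basisFun_apply]; rfl
  -- reindex `b` by `Fin 3 × Fin 3` through an equivalence `ι ≃ Fin 3 × Fin 3` (same cardinality)
  have hcard : Fintype.card ι = Fintype.card (Fin 3 × Fin 3) := by
    rw [← Module.finrank_eq_card_basis b.toBasis, ← Module.finrank_eq_card_basis s.toBasis]
  set g : ι ≃ Fin 3 × Fin 3 := Fintype.equivOfCardEq hcard with hg
  have h := sum_bilin_orthonormalBasis_eq β (b.reindex g) s
  simp only [OrthonormalBasis.reindex_apply, hs_apply] at h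
  rw [← h, ← g.symm.sum_comp]

/-! ### 2. Hopf's minimum principle for `𝔥 − E` on `ℝ⁹` -/

/-- ★ **Strong minimum principle for eigenfunctions of `𝔥`.**  If `f ∈ C²(ℝ⁹)`, `f ≥ 0`, `𝔥f = Ef`, and
`f(x₀) = 0` for some `x₀`, then `f ≡ 0`.  (Write the equation as `−½Δf + (V−E)⁺f = (V−E)⁻f ≥ 0`; the
operator `−½Δ + (V−E)⁺` is uniformly elliptic with continuous coefficients and zeroth-order term `≥ 0`,
so E. Hopf's minimum principle with `m = 0` applies on the connected open set `ℝ⁹`.)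
[cite: LopezGomez2012, Thm. 1.2] [cite: ReedSimonIV1978, Thm. XIII.48] -/
theorem eq_zero_of_nonneg_of_hApply_eq {f : ZM → ℝ} {E : ℝ} (hf : ContDiff ℝ 2 f)
    (hpos : ∀ x, 0 ≤ f x) (heq : ∀ x, hApply f x = E * f x) {x₀ : ZM} (hx₀ : f x₀ = 0) (x : ZM) :
    f x = 0 := by
  -- the reindexing isometry `ℝ⁹ = (ℝ³)³ ≃ EuclideanSpace ℝ (Fin 9)`
  set e : ZM ≃ₗᵢ[ℝ] EuclideanSpace ℝ (Fin (3 * 3)) :=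
    LinearIsometryEquiv.piLpCongrLeft 2 ℝ ℝ finProdFinEquiv with he
  set L : EuclideanSpace ℝ (Fin (3 * 3)) →L[ℝ] ZM :=
    (e.symm.toContinuousLinearEquiv : EuclideanSpace ℝ (Fin (3 * 3)) →L[ℝ] ZM) with hL
  have hLe : ∀ y, L y = e.symm y := fun y => rfl
  have hLex : ∀ z : ZM, L (e z) = z := fun z => by rw [hLe, e.symm_apply_apply]
  -- the transported function and coefficients
  have hU2 : ContDiff ℝ 2 fun y => f (L y) := hf.comp L.contDiff
  have hcV : Continuous fun y : EuclideanSpace ℝ (Fin (3 * 3)) => luscherPotential (L y) :=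
    (contDiff_luscherPotential (n := 0)).continuous.comp L.continuous
  -- the trace of the transported Hessian is the Laplacian
  set b9 : OrthonormalBasis (Fin (3 * 3)) ℝ ZM := (EuclideanSpace.basisFun (Fin (3 * 3)) ℝ).map e.symm
    with hb9
  have hb9_apply : ∀ i, b9 i = L (EuclideanSpace.single i 1) := fun i => by
    rw [hb9, OrthonormalBasis.map_apply, EuclideanSpace.basisFun_apply, hLe]
  have htrace : ∀ y, ∑ i, ∑ j, (if i = j then (1 / 2 : ℝ) else 0) *
      fderiv ℝ (fderiv ℝ (fun y => f (L y))) y (EuclideanSpace.single i 1) (EuclideanSpace.single j 1)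
      = (1 / 2 : ℝ) * laplacian f (L y) := by
    intro y
    have h1 : ∀ i : Fin (3 * 3), ∑ j, (if i = j then (1 / 2 : ℝ) else 0) *
        fderiv ℝ (fderiv ℝ (fun y => f (L y))) y (EuclideanSpace.single i 1) (EuclideanSpace.single j 1)
        = (1 / 2 : ℝ) * fderiv ℝ (fderiv ℝ f) (L y) (b9 i) (b9 i) := by
      intro i
      simp only [ite_mul, zero_mul, Finset.sum_ite_eq, Finset.mem_univ, if_true]
      rw [fderiv_fderiv_comp_clm L hf, hb9_apply]
    simp only [h1, ← Finset.mul_sum]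
    rw [laplacian_eq_sum_fderiv_fderiv_onb b9 hf]
  -- Hopf's minimum principle for `𝔏 = -½Δ + (V - E)⁺` on `Ω = univ`
  have hH := Literature.Analysis.PDE.hopf_minimumPrinciple (N := 3 * 3) (Ω := univ)
    (a := fun _ i j => if i = j then (1 / 2 : ℝ) else 0) (b := fun _ _ => (0 : ℝ))
    (c := fun y => max (luscherPotential (L y) - E) 0) (u := fun y => f (L y)) (μ := 1 / 2) (m := 0)
    isOpen_univ convex_univ.isPreconnected
    (fun _ _ i j => by
      by_cases h : i = j
      · subst h; rfl
      · rw [if_neg h, if_neg (Ne.symm h)])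
    (by norm_num)
    (fun y _ ξ => by
      simp only [ite_mul, zero_mul, Finset.sum_ite_eq, Finset.mem_univ, if_true]
      rw [EuclideanSpace.real_norm_sq_eq, Finset.mul_sum]
      exact le_of_eq (Finset.sum_congr rfl fun i _ => by ring))
    (fun K _ hK => by
      obtain ⟨C, hC⟩ := hK.exists_bound_of_continuousOn
        ((hcV.sub continuous_const).max continuous_const).continuousOn
      refine ⟨max C (1 / 2), fun y hy => ⟨fun i j => ?_, fun i => ?_, ?_⟩⟩
      · by_cases h : i = j
        · rw [if_pos h, abs_of_pos (by norm_num : (0 : ℝ) < 1 / 2)]; exact le_max_right _ _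
        · rw [if_neg h, abs_zero]; exact le_trans (by norm_num) (le_max_right _ _)
      · rw [abs_zero]; exact le_trans (by norm_num) (le_max_right _ _)
      · exact le_trans (by simpa [Real.norm_eq_abs] using hC y hy) (le_max_left _ _))
    (fun y _ => le_max_right _ _) hU2.contDiffOn
    (fun y _ => by
      rw [htrace y]
      have h := heq (L y)
      rw [hApply_def] at h
      simp only [zero_mul, Finset.sum_const_zero, add_zero]
      have hmax : 0 ≤ max (luscherPotential (L y) - E) 0 - (luscherPotential (L y) - E) := by
        rw [sub_nonneg]; exact le_max_left _ _
      nlinarith [hpos (L y), hmax])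
    le_rfl (fun y _ => hpos (L y)) (mem_univ (e x₀)) (by simp only [hLex]; exact hx₀)
  have := hH (e x) (mem_univ _)
  simpa only [hLex] using this

/-- **Dichotomy**: a non-negative `C²` eigenfunction of `𝔥` is either strictly positive everywhere or
identically zero. [cite: LopezGomez2012, Thm. 1.2] [cite: ReedSimonIV1978, Thm. XIII.48] -/
theorem pos_or_eq_zero_of_nonneg_of_hApply_eq {f : ZM → ℝ} {E : ℝ} (hf : ContDiff ℝ 2 f)
    (hpos : ∀ x, 0 ≤ f x) (heq : ∀ x, hApply f x = E * f x) :
    (∀ x, 0 < f x) ∨ (∀ x, f x = 0) := by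
  by_cases h : ∃ x₀, f x₀ = 0
  · obtain ⟨x₀, hx₀⟩ := h
    exact Or.inr (eq_zero_of_nonneg_of_hApply_eq hf hpos heq hx₀)
  · exact Or.inl fun x => lt_of_le_of_ne (hpos x) fun hx => h ⟨x, hx.symm⟩

/-! ### 3. Positivity improving, variational form -/

/-- ★ **Positivity improving for `𝔥` on the invariant sector (variational form).**  Let `w ∈ L²(ℝ⁹)` lie in
the `L²`-closure of the invariant core, satisfy the weak eigen-equation `∫ w·𝔥g = c ∫ w·g` against the
invariant core functions, and be non-negative and non-zero.  Then `⟪w, v⟫ > 0` for every non-zero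
non-negative `v ∈ L²`: by N3/N4 `w` agrees a.e. with a smooth solution `f ≥ 0`, `f ≢ 0`, of `𝔥f = cf`,
which is strictly positive by Hopf's principle, and `∫ f v > 0`.  This is hypothesis `hpos` of
`Literature.Analysis.UnboundedOperators.sInf_coreLevelSet_zero_lt_one` for Lüscher's Hamiltonian.
[cite: ReedSimonIV1978, Thm. XIII.48] [cite: LiebLoss2001, Thm. 11.8, PDF pp. 205–206] -/
theorem inner_pos_of_weak_invariant_nonneg {w : Lp ℝ 2 (volume : Measure ZM)} {c : ℝ}
    (hw : w ∈ closure {v : Lp ℝ 2 (volume : Measure ZM) |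
      ∃ ψ : ZM → ℝ, IsTestFn ψ ∧ IsGaugeInv ψ ∧ (v : ZM → ℝ) =ᵐ[volume] ψ})
    (hweak : ∀ g : ZM → ℝ, IsTestFn g → IsGaugeInv g →
      ∫ x, w x * hApply g x = c * ∫ x, w x * g x)
    (hw0 : 0 ≤ w) (hwne : w ≠ 0) (v : Lp ℝ 2 (volume : Measure ZM)) (hv0 : 0 ≤ v) (hvne : v ≠ 0) :
    0 < ⟪w, v⟫ := by
  obtain ⟨f, hf, -, hwf, hfE, -⟩ := exists_smooth_gaugeInv_classical_of_weak hw hweak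
  have hfc : Continuous f := (hf 0).continuous
  -- `f ≥ 0` everywhere (a.e. from `w ≥ 0`, everywhere by continuity)
  have hw0' : 0 ≤ᵐ[volume] (w : ZM → ℝ) := (Lp.coeFn_nonneg w).2 hw0
  have hf0 : ∀ x, 0 ≤ f x := by
    have hmin : (fun x => min (f x) 0) =ᵐ[volume] fun _ => (0 : ℝ) := by
      filter_upwards [hw0', hwf] with x h0 h1
      rw [← h1]
      exact min_eq_right h0
    have hcont : Continuous fun x => min (f x) 0 := hfc.min continuous_const
    have heq := (hcont.ae_eq_iff_eq volume continuous_const).1 hmin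
    intro x
    exact min_eq_right_iff.1 (congrFun heq x)
  -- `f ≢ 0` (else `w = 0`)
  have hfne : ¬ ∀ x, f x = 0 := by
    intro h
    apply hwne
    apply Lp.ext
    refine hwf.trans ?_
    rw [show f = fun _ => 0 from funext h]
    exact (Lp.coeFn_zero ℝ 2 volume).symm
  -- hence `f > 0` everywhere (Hopf)
  have hfpos : ∀ x, 0 < f x :=
    (pos_or_eq_zero_of_nonneg_of_hApply_eq (hf 2) hf0 hfE).resolve_right hfne
  -- `⟪w, v⟫ = ∫ w v > 0`
  have hv0' : 0 ≤ᵐ[volume] (v : ZM → ℝ) := (Lp.coeFn_nonneg v).2 hv0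
  rw [MeasureTheory.L2.inner_def]
  have hint : Integrable (fun x => ⟪w x, v x⟫) volume := L2.integrable_inner (𝕜 := ℝ) w v
  have hnn : 0 ≤ᵐ[volume] fun x => ⟪w x, v x⟫ := by
    filter_upwards [hw0', hv0'] with x h1 h2
    simp only [RCLike.inner_apply, conj_trivial, Pi.zero_apply] at h1 h2 ⊢
    exact mul_nonneg h2 h1
  refine (integral_pos_iff_support_of_nonneg_ae hnn hint).2 ?_
  by_contra hsupp
  have h0 : volume (support fun x => ⟪w x, v x⟫) = 0 := nonpos_iff_eq_zero.1 (not_lt.1 hsupp)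
  rw [measure_eq_zero_iff_ae_notMem] at h0
  apply hvne
  apply Lp.ext
  refine EventuallyEq.trans ?_ (Lp.coeFn_zero ℝ 2 volume).symm
  filter_upwards [h0, hwf] with x hx hxf
  simp only [mem_support, not_not, RCLike.inner_apply, conj_trivial] at hx
  rcases mul_eq_zero.1 hx with h | h
  · exact h
  · rw [hxf] at h; exact absurd h (hfpos x).ne'

end Literature.Analysis.OperatorTheory.YMMatrixModel

end
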